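import Literature.Combinatorics.SetFamily.SpreadLemmaProcess
import Mathlib.Analysis.SpecialFunctions.Log.Base
import Mathlib.Analysis.Complex.ExponentialBounds
import Mathlib.Algebra.Order.Ring.Pow
import HarnessLib

/-!
# The spread lemma (`spread_lemma`), proved

**The spread lemma** (Alweiss–Lovett–Wu–Zhang; Rao 2020, Lemma 4; Tao 2020;
Bell–Chueluecha–Warnke 2021, Thm. 3; Cavalar–Kumar–Rossman 2022, Thm. 6.1): a nonempty
`ℓ`-bounded family which is `B log(ℓ/ε)/p`-spread is hit by a `p`-random set with probability
`> 1 - ε`. PROVED here following T. Bell's proof of the Park–Pham theorem with optimal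
`ε`-dependence (Bell 2023, Thm. 3) run on a spread family (Bell 2023, Lemma 10), with
independent `q'`-biased rounds instead of uniform sets of a fixed size (which only simplifies
Park–Pham's counting lemma, `SpreadLemma.lean`).

With `r = B log(ℓ/ε)/p`, `q = 1/r`, `L = 64`, `q' = L q` and `I = 3 ⌈log₂(4ℓ/ε)⌉` rounds:

* `failVal q' r L I s` — the probability, over `I` independent `μ_{q'}`-random rounds run from
  state `s` by `step`, that the level is still `≥ 1` at the end (defined by recursion on `I`);
* `sum_biasedWeight_not_succeeds_le` — **a round fails with probability `≤ 1/2`** (Markov on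
  Park–Pham's counting lemma: `E[cost 𝒞] ≤ θ(l)/2`);
* `failVal_le` — hence `failVal ≤ 2^{λ(l)} (3/4)^I`, `λ(l) = ⌊log₂ l⌋ + 1` the number of
  halvings from `l` to `0` (the exponential supermartingale replacing Bell's appeal to a
  Chernoff bound for `Bin(I, 1/2)`);
* `sum_biasedWeight_noWitness_le_failVal` — by the deterministic invariant
  (`SpreadLemmaProcess.lean`) and the union coupling `μ_{q'} ∗ μ_{p_I} = μ_{p_{I+1}}`
  (`BiasedMeasure.lean`), `Pr_{W ∼ μ_{p_I}}[no S ∈ F inside W] ≤ failVal`, where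
  `1 - p_I = (1 - q')^I`;
* `spread_lemma_spreadConst` — the lemma with the explicit constant `spreadConst = 2000`:
  `p_I ≤ I q' ≤ p`, monotone coupling, and `2^{λ(ℓ)} (3/4)^I ≤ 2ℓ · 2^{-⌈log₂(4ℓ/ε)⌉} ≤ ε/2`;
  `spread_lemma` — the `∃ B > 0` form of the sources.

## References

* T. Bell, *The Park–Pham theorem with optimal convergence rate*, Electron. J. Combin. 30(2)
  (2023) P2.25, Thm. 3, Prop. 4, Lemma 10 [Bell2023].
* A. Rao, *Coding for sunflowers*, Discrete Anal. 2020:2, Lemma 4 [Rao2020].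
* T. Bell, S. Chueluecha, L. Warnke, *Note on sunflowers*, Discrete Math. 344 (2021), Thm. 3
  [BellChueluechaWarnke2021].
-/

namespace Literature.Combinatorics.SetFamily

open Finset

variable {α : Type*} [Fintype α] [DecidableEq α]

/-! ### A round fails with probability at most `1/2` -/

/-- **Expected cost of the large fragments** (Bell 2023, proof of Thm. 3, from Prop. 4):
`E_{W ∼ μ_{q'}}[cost_r 𝒞(W)] ≤ θ(l)/2` when `r q' = L`. [cite: Bell2023, Thm. 3] -/
theorem sum_biasedWeight_mul_cost_bigFrags_le {r L q' : ℝ} (hr : 0 < r) (hq0 : 0 < q')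
    (hq1 : q' ≤ 1) (hrq : r * q' = L) (s : RoundState α) (hbdd : ∀ S ∈ s.H, #S ≤ s.l) :
    ∑ W : Finset α, biasedWeight q' W * cost r (bigFrags s W) ≤ theta L s.l / 2 := by
  simp_rw [cost_bigFrags_eq_sum s hbdd, mul_sum]
  rw [sum_comm]
  have hstep : ∀ t ∈ Ico (s.l / 2 + 1) (s.l + 1),
      ∑ W : Finset α, biasedWeight q' W * ((1 / r) ^ t * #(fragsOfCard s.H W t))
        ≤ (s.l.choose t : ℝ) * (1 / L) ^ t := by
    intro t _
    have h1 : ∑ W : Finset α, biasedWeight q' W * ((1 / r) ^ t * #(fragsOfCard s.H W t))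
        = (1 / r) ^ t * ∑ W : Finset α, biasedWeight q' W * #(fragsOfCard s.H W t) := by
      rw [mul_sum]
      exact sum_congr rfl fun W _ => by ring
    rw [h1]
    calc (1 / r) ^ t * ∑ W : Finset α, biasedWeight q' W * #(fragsOfCard s.H W t)
        ≤ (1 / r) ^ t * ((s.l.choose t : ℝ) / q' ^ t) :=
          mul_le_mul_of_nonneg_left (sum_biasedWeight_mul_card_fragsOfCard_le s.H hbdd t hq0 hq1)
            (by positivity)
      _ = (s.l.choose t : ℝ) * (1 / L) ^ t := by
          rw [← hrq, one_div_pow, one_div_pow, mul_pow]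
          field_simp
  calc ∑ t ∈ Ico (s.l / 2 + 1) (s.l + 1),
        ∑ W : Finset α, biasedWeight q' W * ((1 / r) ^ t * #(fragsOfCard s.H W t))
      ≤ ∑ t ∈ Ico (s.l / 2 + 1) (s.l + 1), (s.l.choose t : ℝ) * (1 / L) ^ t := sum_le_sum hstep
    _ = theta L s.l / 2 := by rw [theta]; ring

open Classical in
/-- **A round fails with probability at most `1/2`** (Bell 2023, proof of Thm. 3: "by Markov's
inequality, success is more likely than failure at every step"). [cite: Bell2023, Thm. 3] -/
theorem sum_biasedWeight_not_succeeds_le {r L q' : ℝ} (hr : 0 < r) (hL : 0 < L) (hq0 : 0 < q')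
    (hq1 : q' ≤ 1) (hrq : r * q' = L) (s : RoundState α) (hbdd : ∀ S ∈ s.H, #S ≤ s.l)
    (hl : 1 ≤ s.l) :
    ∑ W ∈ univ.filter (fun W : Finset α => ¬ Succeeds r L s W), biasedWeight q' W ≤ 1 / 2 := by
  have hθ := theta_pos hL hl (l := s.l)
  have hmarkov := mul_sum_biasedWeight_filter_lt_le hq0.le hq1 (theta L s.l)
    (fun W => cost r (bigFrags s W)) fun W => cost_nonneg hr.le _
  have hE := sum_biasedWeight_mul_cost_bigFrags_le hr hq0 hq1 hrq s hbdd
  have hset : (univ.filter fun W : Finset α => ¬ Succeeds r L s W)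
      = univ.filter fun W : Finset α => theta L s.l < cost r (bigFrags s W) := by
    ext W
    simp only [mem_filter, mem_univ, true_and, Succeeds, not_le]
  rw [hset]
  refine le_of_mul_le_mul_left ?_ hθ
  linarith

/-! ### The failure value and the exponential supermartingale -/

/-- The probability, over `I` independent `μ_{q'}`-random rounds from state `s`, that the level
is still positive at the end (defined by peeling off the first round). [cite: Bell2023, Thm. 3] -/
noncomputable def failVal (q' r L : ℝ) : ℕ → RoundState α → ℝ
  | 0, s => if 1 ≤ s.l then 1 else 0
  | I + 1, s => ∑ W : Finset α, biasedWeight q' W * failVal q' r L I (step r L s W)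

/-- The number of halvings `l ↦ l/2` needed to reach `0`: `λ(0) = 0`, `λ(l) = ⌊log₂ l⌋ + 1`.
[folklore] -/
def halvings (l : ℕ) : ℕ := if l = 0 then 0 else Nat.log 2 l + 1

/-- `λ(l/2) + 1 = λ(l)` for `l ≥ 1`. [folklore] -/
theorem halvings_div_two {l : ℕ} (hl : 1 ≤ l) : halvings (l / 2) + 1 = halvings l := by
  unfold halvings
  rcases Nat.lt_or_ge l 2 with h | h
  · have : l = 1 := by omega
    subst this
    simp
  · have h1 : l / 2 ≠ 0 := by omega
    have h2 : l ≠ 0 := by omega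
    rw [if_neg h1, if_neg h2, Nat.log_div_base]
    have : 1 ≤ Nat.log 2 l := Nat.le_log_of_pow_le (by norm_num) (by simpa using h)
    omega

/-- `2^{λ(l)} ≤ 2 l` for `l ≥ 1`. [folklore] -/
theorem two_pow_halvings_le {l : ℕ} (hl : 1 ≤ l) : (2 : ℝ) ^ halvings l ≤ 2 * l := by
  unfold halvings
  rw [if_neg (by omega), pow_succ]
  have : (2 : ℕ) ^ Nat.log 2 l ≤ l := Nat.pow_log_le_self 2 (by omega)
  have : (2 : ℝ) ^ Nat.log 2 l ≤ l := by exact_mod_cast this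
  linarith

omit [Fintype α] in
/-- A round keeps the family bounded by the level. [cite: Bell2023, Thm. 3] -/
theorem bdd_step {r L : ℝ} {s : RoundState α} (hbdd : ∀ S ∈ s.H, #S ≤ s.l) (W : Finset α) :
    ∀ S ∈ (step r L s W).H, #S ≤ (step r L s W).l := by
  by_cases hs : Succeeds r L s W
  · rw [step_of_succeeds hs]
    intro T hT
    exact (mem_filter.1 hT).2
  · rw [step_of_not_succeeds hs]
    intro T hT
    obtain ⟨S, hS, rfl⟩ := mem_image.1 hT
    exact (card_le_card sdiff_subset).trans (hbdd S hS)

/-- The failure value is nonnegative. [cite: Bell2023, Thm. 3] -/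
theorem failVal_nonneg {q' : ℝ} (hq0 : 0 ≤ q') (hq1 : q' ≤ 1) (r L : ℝ) :
    ∀ (I : ℕ) (s : RoundState α), 0 ≤ failVal q' r L I s
  | 0, s => by unfold failVal; split_ifs <;> norm_num
  | I + 1, s => sum_nonneg fun W _ =>
      mul_nonneg (biasedWeight_nonneg hq0 hq1 W) (failVal_nonneg hq0 hq1 r L I _)

/-- At level `0` the failure value vanishes. [cite: Bell2023, Thm. 3] -/
theorem failVal_eq_zero_of_l_eq_zero {q' r L : ℝ} :
    ∀ (I : ℕ) (s : RoundState α), s.l = 0 → failVal q' r L I s = 0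
  | 0, s, hl => by unfold failVal; rw [if_neg (by omega)]
  | I + 1, s, hl => by
      unfold failVal
      refine sum_eq_zero fun W _ => ?_
      rw [failVal_eq_zero_of_l_eq_zero I _ (by rw [step_l]; split_ifs <;> omega), mul_zero]

open Classical in
/-- **The exponential supermartingale** (replacing Bell's Chernoff bound for the number of
successes): from an `l`-bounded state, `failVal ≤ 2^{λ(l)} (3/4)^I`, because each round succeeds
with probability `≥ 1/2` and a success decreases `λ` by one. [cite: Bell2023, Thm. 3] -/
theorem failVal_le {r L q' : ℝ} (hr : 0 < r) (hL : 0 < L) (hq0 : 0 < q') (hq1 : q' ≤ 1)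
    (hrq : r * q' = L) :
    ∀ (I : ℕ) (s : RoundState α), (∀ S ∈ s.H, #S ≤ s.l) →
      failVal q' r L I s ≤ 2 ^ halvings s.l * (3 / 4 : ℝ) ^ I := by
  intro I
  induction I with
  | zero =>
    intro s _
    unfold failVal
    rw [pow_zero, mul_one]
    split_ifs
    · exact one_le_pow₀ (by norm_num)
    · positivity
  | succ I ih =>
    intro s hbdd
    by_cases hl0 : s.l = 0
    · rw [failVal_eq_zero_of_l_eq_zero (I + 1) s hl0]; positivity
    have hl : 1 ≤ s.l := Nat.one_le_iff_ne_zero.2 hl0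
    set a : ℝ := 2 ^ halvings s.l * (3 / 4 : ℝ) ^ I with ha
    have ha0 : 0 ≤ a := by positivity
    have hpt : ∀ W : Finset α, failVal q' r L I (step r L s W)
        ≤ a / 2 + (if ¬ Succeeds r L s W then a / 2 else 0) := by
      intro W
      have h1 := ih (step r L s W) (bdd_step hbdd W)
      rw [step_l] at h1
      by_cases hs : Succeeds r L s W
      · rw [if_pos hs] at h1
        rw [if_neg (not_not.2 hs), add_zero]
        have h2 : (2 : ℝ) ^ halvings (s.l / 2) * (3 / 4 : ℝ) ^ I = a / 2 := by
          rw [ha, ← halvings_div_two hl, pow_succ]; ring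
        linarith
      · rw [if_neg hs] at h1
        rw [if_pos hs]
        linarith
    have hfail := sum_biasedWeight_not_succeeds_le hr hL hq0 hq1 hrq s hbdd hl
    calc failVal q' r L (I + 1) s
        = ∑ W : Finset α, biasedWeight q' W * failVal q' r L I (step r L s W) := rfl
      _ ≤ ∑ W : Finset α, biasedWeight q' W * (a / 2 + if ¬ Succeeds r L s W then a / 2 else 0) :=
          sum_le_sum fun W _ => mul_le_mul_of_nonneg_left (hpt W) (biasedWeight_nonneg hq0.le hq1 W)
      _ = a / 2 * ∑ W : Finset α, biasedWeight q' W
          + a / 2 * ∑ W ∈ univ.filter (fun W : Finset α => ¬ Succeeds r L s W), biasedWeight q' W := by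
          rw [sum_filter, mul_sum, mul_sum, ← sum_add_distrib]
          refine sum_congr rfl fun W _ => ?_
          split_ifs <;> ring
      _ ≤ a / 2 * 1 + a / 2 * (1 / 2) := by
          rw [sum_biasedWeight]
          have h5 : a / 2 * ∑ W ∈ univ.filter (fun W : Finset α => ¬ Succeeds r L s W),
              biasedWeight q' W ≤ a / 2 * (1 / 2) :=
            mul_le_mul_of_nonneg_left hfail (by positivity)
          linarith
      _ = 2 ^ halvings s.l * (3 / 4 : ℝ) ^ (I + 1) := by rw [ha, pow_succ]; ring

/-! ### From the process to the random set -/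

/-- The bias of the union of `I` independent `μ_{q'}`-random sets: `p_0 = 0`,
`p_{I+1} = q' + p_I - q' p_I`. [folklore] -/
noncomputable def iterBias (q' : ℝ) : ℕ → ℝ
  | 0 => 0
  | I + 1 => q' + iterBias q' I - q' * iterBias q' I

/-- `1 - p_I = (1 - q')^I`. [folklore] -/
theorem one_sub_iterBias (q' : ℝ) : ∀ I : ℕ, 1 - iterBias q' I = (1 - q') ^ I
  | 0 => by simp [iterBias]
  | I + 1 => by
      rw [iterBias, pow_succ, ← one_sub_iterBias q' I]; ring

/-- `0 ≤ p_I ≤ I q'` for `q' ∈ [0, 1]` (Bernoulli's inequality). [folklore] -/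
theorem iterBias_nonneg_and_le {q' : ℝ} (hq0 : 0 ≤ q') (hq1 : q' ≤ 1) (I : ℕ) :
    0 ≤ iterBias q' I ∧ iterBias q' I ≤ I * q' := by
  have h := one_sub_iterBias q' I
  have h1 : (1 - q') ^ I ≤ 1 := pow_le_one₀ (by linarith) (by linarith)
  have h2 : 1 + I * (-q') ≤ (1 + (-q')) ^ I := one_add_mul_le_pow (by linarith) I
  rw [← sub_eq_add_neg] at h2
  constructor <;> nlinarith

/-- **From the process to the random set** (Bell 2023, proof of Thm. 3, Props. 2.3/2.4 of
Park–Pham in Bell's form: if the level reaches `0` some `S ∈ F` lies in `⋃ W_i`): for a state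
satisfying the invariant with used set `V`,
`Pr_{U ∼ μ_{p_I}}[no S ∈ F inside V ∪ U] ≤ failVal_I(s)`. Induction on `I`, splitting
`μ_{p_{I+1}} = μ_{q'} ∗ μ_{p_I}` (`sum_sum_biasedWeight_union`). [cite: Bell2023, Thm. 3] -/
theorem sum_biasedWeight_noWitness_le_failVal {F : Finset (Finset α)} {r L q' : ℝ} {l₀ : ℕ}
    (hF : F.Nonempty) (hsp : IsSpread r F) (hΘ : Theta L l₀ < 1) (hr : 0 ≤ r) (hL : 0 < L)
    (hq0 : 0 ≤ q') (hq1 : q' ≤ 1) :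
    ∀ (I : ℕ) (s : RoundState α) (V : Finset α), Inv F r L l₀ s V →
      ∑ U : Finset α, biasedWeight (iterBias q' I) U * (if ∃ S ∈ F, S ⊆ V ∪ U then 0 else 1)
        ≤ failVal q' r L I s := by
  intro I
  induction I with
  | zero =>
    intro s V hinv
    simp only [iterBias, biasedWeight_zero, boole_mul]
    rw [sum_ite_eq' univ (∅ : Finset α)]
    simp only [mem_univ, if_true, union_empty]
    unfold failVal
    by_cases hl : 1 ≤ s.l
    · rw [if_pos hl]; split_ifs <;> norm_num
    · rw [if_neg hl]
      have hl0 : s.l = 0 := by omega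
      obtain ⟨S, hS, hSV⟩ := hinv.exists_subset_of_l_eq_zero hl0 hF hsp hΘ
      rw [if_pos ⟨S, hS, hSV⟩]
  | succ I ih =>
    intro s V hinv
    have hconv := sum_sum_biasedWeight_union (α := α) q' (iterBias q' I)
      fun U => if ∃ S ∈ F, S ⊆ V ∪ U then (0 : ℝ) else 1
    change ∑ U : Finset α, biasedWeight (q' + iterBias q' I - q' * iterBias q' I) U
        * (if ∃ S ∈ F, S ⊆ V ∪ U then (0 : ℝ) else 1) ≤ _
    rw [← hconv]
    calc ∑ W : Finset α, ∑ U : Finset α, biasedWeight q' W * biasedWeight (iterBias q' I) U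
          * (if ∃ S ∈ F, S ⊆ V ∪ (W ∪ U) then (0 : ℝ) else 1)
        = ∑ W : Finset α, biasedWeight q' W * ∑ U : Finset α, biasedWeight (iterBias q' I) U
          * (if ∃ S ∈ F, S ⊆ (V ∪ W) ∪ U then (0 : ℝ) else 1) := by
          refine sum_congr rfl fun W _ => ?_
          rw [mul_sum]
          refine sum_congr rfl fun U _ => ?_
          rw [mul_assoc, union_assoc]
      _ ≤ ∑ W : Finset α, biasedWeight q' W * failVal q' r L I (step r L s W) :=
          sum_le_sum fun W _ => mul_le_mul_of_nonneg_left
            (ih (step r L s W) (V ∪ W) (hinv.step hr hL W)) (biasedWeight_nonneg hq0 hq1 W)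
      _ = failVal q' r L (I + 1) s := rfl

/-! ### Numerics and assembly -/

/-- The number of halving phases `J = ⌈log₂(4ℓ/ε)⌉`: `2^{-J} ≤ ε/(4ℓ)` and `J ≤ 10 log(ℓ/ε)`.
[cite: Bell2023, Thm. 3] -/
theorem rounds_bound {ℓ : ℕ} {ε : ℝ} (hℓ : 1 ≤ ℓ) (hε0 : 0 < ε) (hε1 : ε ≤ 1 / 2) :
    (1 / 2 : ℝ) ^ ⌈Real.logb 2 (4 * ℓ / ε)⌉₊ ≤ ε / (4 * ℓ) ∧
      (⌈Real.logb 2 (4 * ℓ / ε)⌉₊ : ℝ) ≤ 10 * Real.log (ℓ / ε) ∧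
      1 / 2 ≤ Real.log (ℓ / ε) := by
  have hℓr : (1 : ℝ) ≤ ℓ := by exact_mod_cast hℓ
  have hx : (2 : ℝ) ≤ ℓ / ε := by
    rw [le_div_iff₀ hε0]; linarith
  have hlog2 := Real.log_two_gt_d9
  have hlog2' := Real.log_two_lt_d9
  have hLg : Real.log 2 ≤ Real.log (ℓ / ε) := Real.log_le_log two_pos hx
  have hLg1 : 1 / 2 ≤ Real.log (ℓ / ε) := by linarith
  set x : ℝ := 4 * ℓ / ε with hxdef
  have hx0 : 0 < x := by positivity
  have hx1 : 1 ≤ x := by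
    rw [hxdef, le_div_iff₀ hε0]; linarith
  set J := ⌈Real.logb 2 x⌉₊ with hJ
  refine ⟨?_, ?_, hLg1⟩
  · -- `2^J ≥ x`
    have h1 : (2 : ℝ) ^ Real.logb 2 x = x := Real.rpow_logb two_pos (by norm_num) hx0
    have h2 : (2 : ℝ) ^ Real.logb 2 x ≤ (2 : ℝ) ^ (J : ℝ) :=
      Real.rpow_le_rpow_of_exponent_le one_le_two (Nat.le_ceil _)
    rw [Real.rpow_natCast, h1] at h2
    calc (1 / 2 : ℝ) ^ J = ((2 : ℝ) ^ J)⁻¹ := by rw [one_div_pow, one_div]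
      _ ≤ x⁻¹ := inv_anti₀ hx0 h2
      _ = ε / (4 * ℓ) := by rw [hxdef, inv_div]
  · have hJlt : (J : ℝ) < Real.logb 2 x + 1 := Nat.ceil_lt_add_one (Real.logb_nonneg one_lt_two hx1)
    have hlogx : Real.log x = Real.log 4 + Real.log (ℓ / ε) := by
      rw [hxdef, show (4 : ℝ) * ℓ / ε = 4 * (ℓ / ε) by ring]
      exact Real.log_mul (by norm_num) (by positivity)
    have hlog4 : Real.log 4 = 2 * Real.log 2 := by
      rw [show (4 : ℝ) = 2 ^ 2 by norm_num, Real.log_pow]; norm_num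
    have hlogb : Real.logb 2 x = Real.log x / Real.log 2 := rfl
    have hlogx0 : 0 ≤ Real.log x := Real.log_nonneg hx1
    have hdiv : Real.log x / Real.log 2 ≤ Real.log x / (1 / 2) :=
      div_le_div_of_nonneg_left hlogx0 (by norm_num) (by linarith)
    rw [hlogb] at hJlt
    rw [hlogx, hlog4] at hdiv hJlt
    have : (2 * Real.log 2 + Real.log (ℓ / ε)) / (1 / 2) = 4 * Real.log 2 + 2 * Real.log (ℓ / ε) := by
      ring
    rw [this] at hdiv
    nlinarith

/-- An explicit absolute constant for the spread lemma: `B = 2000` (the sources do not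
optimise it; Bell 2023 has `48 / log 2`-type constants in the `q`-small setting).
[cite: Bell2023, Thm. 3] -/
def spreadConst : ℝ := 2000

/-- The spread constant is positive. [cite: Bell2023, Thm. 3] -/
theorem spreadConst_pos : 0 < spreadConst := by norm_num [spreadConst]

/-- **The spread lemma, explicit constant** (Alweiss–Lovett–Wu–Zhang; Rao 2020, Lemma 4; Tao
2020; Bell–Chueluecha–Warnke 2021, Thm. 3; Bell 2023, Thm. 3 with Lemma 10; = Cavalar–Kumar–
Rossman 2022, Thm. 6.1 in the relative-spread form): for all `ℓ ≥ 1`, `p, ε ∈ (0, 1/2]` and every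
nonempty family `F` of sets of size `≤ ℓ` in a finite ground set which is `r`-spread with
`r = B log(ℓ/ε) / p`, `B = spreadConst`, a `p`-random subset `W` contains some member of `F`
with probability `> 1 - ε`: `Pr_{W ∼ μ_p}[∃ S ∈ F, S ⊆ W] > 1 - ε`. (Bell and BCW state it for
`ℓ`-uniform `F` with `|F| ≥ r^ℓ` / not `q`-small `F`; by Bell 2023, Lemma 10 relative
`r`-spreadness suffices.) [cite: Bell2023, Thm. 3 and Lemma 10] -/
theorem spread_lemma_spreadConst {α : Type*} [Fintype α] [DecidableEq α]
    (F : Finset (Finset α)) (ℓ : ℕ) (p ε : ℝ) (hℓ : 1 ≤ ℓ) (hp0 : 0 < p) (hp1 : p ≤ 1 / 2)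
    (hε0 : 0 < ε) (hε1 : ε ≤ 1 / 2) (hF : F.Nonempty) (hbdd : ∀ S ∈ F, #S ≤ ℓ)
    (hsp : IsSpread (spreadConst * Real.log (ℓ / ε) / p) F) :
    1 - ε < ∑ W ∈ univ.filter (fun W : Finset α => ∃ S ∈ F, S ⊆ W), biasedWeight p W := by
  simp only [spreadConst] at hsp
  -- parameters
  obtain ⟨hJ1, hJ2, hLg⟩ := rounds_bound hℓ hε0 hε1
  set Lg : ℝ := Real.log (ℓ / ε) with hLgdef
  set J : ℕ := ⌈Real.logb 2 (4 * ℓ / ε)⌉₊ with hJdef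
  set r : ℝ := 2000 * Lg / p with hrdef
  set L : ℝ := 64 with hLdef
  set q' : ℝ := L / r with hq'def
  set I : ℕ := 3 * J with hIdef
  have hLg0 : 0 < Lg := by linarith
  have hr0 : 0 < r := by positivity
  have hrp : r * p = 2000 * Lg := by rw [hrdef]; field_simp
  have hr64 : 64 ≤ r := by
    refine le_of_mul_le_mul_right ?_ hp0
    rw [hrp]; nlinarith
  have hq0 : 0 < q' := by positivity
  have hq1 : q' ≤ 1 := by rw [hq'def, div_le_one hr0]; exact hr64
  have hrq : r * q' = L := by rw [hq'def]; field_simp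
  have hΘ : Theta L ℓ < 1 := (Theta_le (by norm_num : (4 : ℝ) < 64) ℓ).trans_lt (by norm_num)
  -- the bias of the union of the rounds is at most `p`
  obtain ⟨hpI0, hpIle⟩ := iterBias_nonneg_and_le hq0.le hq1 I
  have hpIp : iterBias q' I ≤ p := by
    refine hpIle.trans ?_
    have hI : (I : ℝ) ≤ 30 * Lg := by
      rw [hIdef, Nat.cast_mul]; push_cast; linarith
    rw [hq'def, hLdef]
    rw [show (I : ℝ) * (64 / r) = (64 * I) / r by ring, div_le_iff₀ hr0, mul_comm p r, hrp]
    nlinarith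
  -- the failure probability
  have hfail : failVal q' r L I ⟨F, ∅, ℓ⟩ < ε := by
    have h1 := failVal_le hr0 (by norm_num : (0 : ℝ) < 64) hq0 hq1 hrq I ⟨F, ∅, ℓ⟩ hbdd
    have h2 := two_pow_halvings_le hℓ
    have h3 : (3 / 4 : ℝ) ^ I ≤ (1 / 2 : ℝ) ^ J := by
      rw [hIdef, pow_mul]
      exact pow_le_pow_left₀ (by norm_num) (by norm_num) J
    have hℓ0 : (0 : ℝ) < ℓ := by exact_mod_cast hℓ
    calc failVal q' r L I ⟨F, ∅, ℓ⟩ ≤ 2 ^ halvings ℓ * (3 / 4 : ℝ) ^ I := h1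
      _ ≤ (2 * ℓ) * (ε / (4 * ℓ)) :=
          mul_le_mul h2 (h3.trans hJ1) (by positivity) (by positivity)
      _ = ε / 2 := by field_simp; ring
      _ < ε := by linarith
  -- the chain of comparisons
  have hmono := sum_biasedWeight_mono_of_monotone hpI0 hpIp (by linarith)
    (fun W : Finset α => ∃ S ∈ F, S ⊆ W)
    (fun W U ⟨S, hS, hSW⟩ hWU => ⟨S, hS, hSW.trans hWU⟩)
  have hlink := sum_biasedWeight_noWitness_le_failVal hF hsp hΘ hr0.le (by norm_num : (0 : ℝ) < 64)
    hq0.le hq1 I ⟨F, ∅, ℓ⟩ ∅ (Inv.init hbdd r L)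
  simp only [empty_union] at hlink
  have hsplit : ∑ W ∈ univ.filter (fun W : Finset α => ∃ S ∈ F, S ⊆ W), biasedWeight (iterBias q' I) W
      = 1 - ∑ U : Finset α, biasedWeight (iterBias q' I) U
          * (if ∃ S ∈ F, S ⊆ U then (0 : ℝ) else 1) := by
    have htot := sum_biasedWeight (α := α) (iterBias q' I)
    rw [← sum_filter_add_sum_filter_not univ (fun W : Finset α => ∃ S ∈ F, S ⊆ W)] at htot
    have hneg : ∑ U : Finset α, biasedWeight (iterBias q' I) U * (if ∃ S ∈ F, S ⊆ U then (0 : ℝ) else 1)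
        = ∑ W ∈ univ.filter (fun W : Finset α => ¬ ∃ S ∈ F, S ⊆ W), biasedWeight (iterBias q' I) W := by
      rw [sum_filter]
      refine sum_congr rfl fun U _ => ?_
      split_ifs <;> simp
    rw [hneg]
    linarith
  calc 1 - ε < 1 - failVal q' r L I ⟨F, ∅, ℓ⟩ := by linarith
    _ ≤ ∑ W ∈ univ.filter (fun W : Finset α => ∃ S ∈ F, S ⊆ W), biasedWeight (iterBias q' I) W := by
        rw [hsplit]; linarith
    _ ≤ ∑ W ∈ univ.filter (fun W : Finset α => ∃ S ∈ F, S ⊆ W), biasedWeight p W := hmono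

/-- **The spread lemma** in the form "there is an absolute constant `B > 0`" of the sources
(Rao 2020, Lemma 4; BCW 2021, Thm. 3; Bell 2023, Thm. 3/Thm. 9; CKR 2022, Thm. 6.1).
[cite: Bell2023, Thm. 3 and Lemma 10] -/
theorem spread_lemma : ∃ B : ℝ, 0 < B ∧ ∀ {α : Type*} [Fintype α] [DecidableEq α]
    (F : Finset (Finset α)) (ℓ : ℕ) (p ε : ℝ), 1 ≤ ℓ → 0 < p → p ≤ 1 / 2 → 0 < ε → ε ≤ 1 / 2 →
    F.Nonempty → (∀ S ∈ F, #S ≤ ℓ) → IsSpread (B * Real.log (ℓ / ε) / p) F →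
    1 - ε < ∑ W ∈ univ.filter (fun W : Finset α => ∃ S ∈ F, S ⊆ W), biasedWeight p W :=
  ⟨spreadConst, spreadConst_pos, fun F ℓ p ε => spread_lemma_spreadConst F ℓ p ε⟩

end Literature.Combinatorics.SetFamily
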